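/-
Copyright (c) 2026. All rights reserved.
Released under Apache 2.0 license as described in the file LICENSE.
Authors: abc-iut cell — seat abc-iut-w4-d104 (gen 4): row «COR28/29-ANALYTIC-VALUES», file 1 — [AbsTopIII]
Cor 2.8 (b): chart-independence of `𝒜_X(U_X)` from ONE analytic input on the genuine values.
-/
import Literature.AnabelianGeometry.AbsoluteAnabelian.ArchimedeanReconstructionCor28ChartIndependence
import Literature.AnabelianGeometry.AbsoluteAnabelian.ArchimedeanReconstructionCor29GenuineInstance
import HarnessLib

/-!
# [AbsTopIII] Cor 2.8 (b): the transitions between the charts `f_U` are bi-analytic — from the analyticity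
# of the genuine values of the NF-rational functions in the chart coordinates

S. Mochizuki, *Topics in absolute anabelian geometry III* (bib key `MochizukiAbsTopIII2015`), Cor 2.8 (b)
pp.63–64: the charts are the homeomorphisms `f_U : U_X ⥲ U_v ⊆ k_v` "defined by `f` on `U_X` [i.e., by taking
limits of Cauchy sequences of values in `k_v`]", `Aut^hol(U_v)` is the group of self-homeomorphisms "which …
can locally be expressed as a convergent power series with coefficients in `k_v`", and
`𝒜_X(U_X) := f_U⁻¹ ∘ Aut^hol(U_v) ∘ f_U`.  PROOF-ONLY file (no definitions).

abc-iut-w5-d140's sub-DAG row Cor-28.b.r11 types the well-definedness of `𝒜_X(U_X)` as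
`NFCurveData.ChartAutIndependent` (p414194) and abc-iut-w4-d104's p438129 proves it from the hypothesis «all
transitions `f′_U ∘ f_U⁻¹` are bi-analytic».  This file reduces that hypothesis to the ONE analytic input the
interface shim `NFCurveData` lacks — stated as a binder, verbatim the same in the Cor 2.9 sequel
`…Cor29OfCharts.lean` (row «COR28/29-ANALYTIC-VALUES»), so that Cor 2.8's chart independence and Cor 2.9's
chart package have the SAME named residual:

**(AV) analytic values.**  On every Cor 2.8 (b) chart `f_U : U_X ⥲ U_v` and for every NF-rational `f′`
REGULAR at a point `u₀ ∈ U_X` (the values `f′(u_j)` along the representative Cauchy sequence of `u₀` converge),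
the GENUINE extended value function `u ↦ lim_j f′(u_j)` (p438727's `fval`) is, near `u₀`, a `k_v`-ANALYTIC
function of the chart coordinate: `lim_j f′(u_j) = F(f_U(u))` with `F` analytic at `f_U(u₀)`.  (For the
genuine `X_v(k_v)`: meromorphic functions are analytic functions of any local holomorphic coordinate off
their poles — the content of print's "locally … a convergent power series".)

* `NFCurveData.Chart.tendsto_valv_fU` — the chart function `f` is regular on `U_X` (its values converge to
  `f_U`, field `fU_spec`);
* `NFCurveData.transition_analytic_of_analyticValues` — (AV) ⇒ the transition `f′_U ∘ f_U⁻¹ : U_v → U′_v` is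
  locally a `k_v`-analytic function at every point of `U_v` (it IS the value function of `f′` read in the
  chart `f_U`, by `Chart.limUnder_valv_eq`);
* `NFCurveData.chartAutIndependent_of_analyticValues` — (AV) ⇒ `D.ChartAutIndependent` (row b.r11), and
  `NFCurveData.reconstructsAutHolOnCharts_of_analyticValues` — (AV) ⇒ Cor 2.8 (b) read on the charted opens
  (w5-d140's repaired node statement `ReconstructsAutHolOnCharts`).

HONEST SCOPE: (AV) is NAMED in binders, not discharged — it is the analytic structure of `X_v(k_v)` / the
comparison `X^top = X_v(k_v)` (Cor-28 rows r8, r11; owed by abc-iut-L4-t1's Thm 1.9 output `ArisesFrom`);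
no `Prop` definition is introduced.  Refereed pre-IUT material; nothing here bears on the disputed [IUTchIII]
Cor. 3.12; typed ≠ endorsed.
-/

noncomputable section

namespace Literature.AnabelianGeometry.AbsoluteAnabelian

namespace ArchimedeanReconstruction

open _root_.Filter _root_.Topology _root_.Set _root_.TopologicalSpace

variable {D : NFCurveData}

/-- **The chart function is regular on its chart**: for a Cor 2.8 (b) chart `f_U : U_X ⥲ U_v` and `u ∈ U_X`,
the values `f(u_j)` along the representative Cauchy sequence of `u` converge, to `f_U(u)` (field `fU_spec`:
`f_U` is "the function defined by `f` [by taking limits]"). [cite: MochizukiAbsTopIII2015, Corollary 2.8 (b) p.63] -/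
theorem NFCurveData.Chart.tendsto_valv_fU {UX : Opens D.Xtop} (c : D.Chart UX) {u : D.Xtop} (hu : u ∈ UX) :
    Tendsto (fun j => D.valv c.f ((Quot.out u).1 j)) atTop (𝓝 ((c.fU ⟨u, hu⟩ : c.Uv) : D.kv)) := by
  have hq : Quot.mk _ (Quot.out u) = u := Quot.out_eq u
  have hu' : Quot.mk _ (Quot.out u) ∈ UX := by rw [hq]; exact hu
  have h := c.fU_spec (Quot.out u) hu'
  have heq : (⟨Quot.mk _ (Quot.out u), hu'⟩ : UX) = ⟨u, hu⟩ := Subtype.ext hq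
  rw [heq] at h
  exact h

/-- **(AV) ⇒ bi-analytic transitions.**  If the genuine extended values of every NF-rational function regular
at a point are analytic in the chart coordinate there (binder `hAV`), then for two charts `f_U`, `f′_U` of the
same `U_X` the transition `f′_U ∘ f_U⁻¹` is, at every `z ∈ U_v`, locally an analytic function of `k_v` — the
hypothesis of abc-iut-w4-d104's `Chart.aut_eq_of_bianalytic_transition` (p438129): the transition IS the value
function of `f′` read in the chart `f_U` (`Chart.limUnder_valv_eq`, p438727).
[cite: MochizukiAbsTopIII2015, Corollary 2.8 (b) p.64] -/
theorem NFCurveData.transition_analytic_of_analyticValues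
    (hAV : ∀ (UX : Opens D.Xtop) (c : D.Chart UX) (f : D.Fn) (x : D.Xtop) (hx : x ∈ UX),
      (∃ a : D.kv, Tendsto (fun j => D.valv f ((Quot.out x).1 j)) atTop (𝓝 a)) →
      ∃ F : D.kv → D.kv, AnalyticAt D.kv F ((c.fU ⟨x, hx⟩ : c.Uv) : D.kv) ∧
        ∀ᶠ u in 𝓝 x, ∀ hu : u ∈ UX,
          limUnder atTop (fun j => D.valv f ((Quot.out u).1 j)) = F ((c.fU ⟨u, hu⟩ : c.Uv) : D.kv))
    {UX : Opens D.Xtop} (c c' : D.Chart UX) (z : c.Uv) :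
    ∃ F : D.kv → D.kv, AnalyticAt D.kv F (z : D.kv) ∧
      ∀ᶠ w in 𝓝 (z : D.kv), ∀ hw : w ∈ c.Uv, F w = ((c'.fU (c.fU.symm ⟨w, hw⟩) : c'.Uv) : D.kv) := by
  -- the point `x = f_U⁻¹ z ∈ U_X`; `f′` is regular there
  set x : UX := c.fU.symm z with hxdef
  have hreg : ∃ a : D.kv, Tendsto (fun j => D.valv c'.f ((Quot.out (x : D.Xtop)).1 j)) atTop (𝓝 a) :=
    ⟨_, c'.tendsto_valv_fU x.2⟩
  obtain ⟨F, hFa, hFe⟩ := hAV UX c c'.f (x : D.Xtop) x.2 hreg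
  have hxz : ((c.fU ⟨(x : D.Xtop), x.2⟩ : c.Uv) : D.kv) = (z : D.kv) := by
    rw [Subtype.coe_eta, hxdef, Homeomorph.apply_symm_apply]
  refine ⟨F, hxz ▸ hFa, ?_⟩
  -- rewrite the value function of `f′` on `U_X` as `f′_U`
  have hFe' : ∀ᶠ u in 𝓝 (x : D.Xtop), ∀ hu : u ∈ UX,
      F ((c.fU ⟨u, hu⟩ : c.Uv) : D.kv) = ((c'.fU ⟨u, hu⟩ : c'.Uv) : D.kv) := by
    filter_upwards [hFe] with u hu hu'
    rw [← hu hu', NFCurveData.Chart.limUnder_valv_eq D c' u hu']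
  -- pull back along the continuous map `w ↦ f_U⁻¹ w : U_v → U_X → X^top`, which sends `z` to `x`
  have hcont : Tendsto (fun w : c.Uv => ((c.fU.symm w : UX) : D.Xtop)) (𝓝 z) (𝓝 (x : D.Xtop)) := by
    have h : Continuous (fun w : c.Uv => ((c.fU.symm w : UX) : D.Xtop)) :=
      continuous_subtype_val.comp c.fU.symm.continuous
    exact h.continuousAt
  have hsub : ∀ᶠ w : c.Uv in 𝓝 z, ∀ hw : (w : D.kv) ∈ c.Uv,
      F (w : D.kv) = ((c'.fU (c.fU.symm ⟨(w : D.kv), hw⟩) : c'.Uv) : D.kv) := by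
    filter_upwards [hcont.eventually hFe'] with w hw hw'
    have hwe : (⟨(w : D.kv), hw'⟩ : c.Uv) = w := Subtype.ext rfl
    have h := hw (c.fU.symm w).2
    rw [Subtype.coe_eta, Homeomorph.apply_symm_apply] at h
    rw [hwe, h]
  have hwithin : ∀ᶠ w in 𝓝[(c.Uv : Set D.kv)] (z : D.kv), ∀ hw : w ∈ c.Uv,
      F w = ((c'.fU (c.fU.symm ⟨w, hw⟩) : c'.Uv) : D.kv) :=
    (eventually_nhds_subtype_iff (c.Uv : Set D.kv) z
      (fun w => ∀ hw : w ∈ c.Uv, F w = ((c'.fU (c.fU.symm ⟨w, hw⟩) : c'.Uv) : D.kv))).1 hsub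
  rwa [c.Uv.isOpen.nhdsWithin_eq z.2] at hwithin

/-- **Row Cor-28.b.r11 from (AV)**: if the genuine values of the NF-rational functions are analytic in every
chart coordinate (binder `hAV`), then `𝒜_X(U_X) := f_U⁻¹ ∘ Aut^hol(U_v) ∘ f_U` does not depend on the chart —
abc-iut-w5-d140's `ChartAutIndependent`, via p438129. [cite: MochizukiAbsTopIII2015, Corollary 2.8 (b) p.64] -/
theorem NFCurveData.chartAutIndependent_of_analyticValues
    (hAV : ∀ (UX : Opens D.Xtop) (c : D.Chart UX) (f : D.Fn) (x : D.Xtop) (hx : x ∈ UX),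
      (∃ a : D.kv, Tendsto (fun j => D.valv f ((Quot.out x).1 j)) atTop (𝓝 a)) →
      ∃ F : D.kv → D.kv, AnalyticAt D.kv F ((c.fU ⟨x, hx⟩ : c.Uv) : D.kv) ∧
        ∀ᶠ u in 𝓝 x, ∀ hu : u ∈ UX,
          limUnder atTop (fun j => D.valv f ((Quot.out u).1 j)) = F ((c.fU ⟨u, hu⟩ : c.Uv) : D.kv)) :
    D.ChartAutIndependent :=
  NFCurveData.chartAutIndependent_of_bianalytic_transitions fun _ c c' z =>
    NFCurveData.transition_analytic_of_analyticValues hAV c c' z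

/-- **Cor 2.8 (b) read on the charted opens, from (AV)**: an Aut-holomorphic structure on `X^top` agreeing
with `f_U⁻¹ ∘ Aut^hol(U_v) ∘ f_U` on every charted connected open exists, uniquely on those opens —
abc-iut-w5-d140's repaired node statement `ReconstructsAutHolOnCharts`.
[cite: MochizukiAbsTopIII2015, Corollary 2.8 (b) p.64] -/
theorem NFCurveData.reconstructsAutHolOnCharts_of_analyticValues
    (hAV : ∀ (UX : Opens D.Xtop) (c : D.Chart UX) (f : D.Fn) (x : D.Xtop) (hx : x ∈ UX),
      (∃ a : D.kv, Tendsto (fun j => D.valv f ((Quot.out x).1 j)) atTop (𝓝 a)) →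
      ∃ F : D.kv → D.kv, AnalyticAt D.kv F ((c.fU ⟨x, hx⟩ : c.Uv) : D.kv) ∧
        ∀ᶠ u in 𝓝 x, ∀ hu : u ∈ UX,
          limUnder atTop (fun j => D.valv f ((Quot.out u).1 j)) = F ((c.fU ⟨u, hu⟩ : c.Uv) : D.kv)) :
    D.ReconstructsAutHolOnCharts :=
  NFCurveData.reconstructsAutHolOnCharts_of_chartAutIndependent
    (NFCurveData.chartAutIndependent_of_analyticValues hAV)

end ArchimedeanReconstruction

end Literature.AnabelianGeometry.AbsoluteAnabelian

end
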